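import Literature.NumberTheory.ComplexMultiplication.EllipticUnits.RayClassLOfNormCharacter
import Mathlib.RingTheory.RootsOfUnity.PrimitiveRoots
import HarnessLib

/-!
# The Artin symbol of `K(𝔪)/K` on the roots of unity IS the norm: for `μ_m ⊂ K(𝔪)` and a Dirichlet character `χ`
# modulo `m`, the ray-class character `ε := χ ∘ χ_cyc` satisfies `ε((𝔟, K(𝔪)/K)) = χ(N𝔟)` — the hypothesis (hε) of
# `isRayClassL_of_norm_character` PROVED (theorems only; NO named fact; NO definition)

Topic `Literature/NumberTheory/ComplexMultiplication/EllipticUnits` (continuing `KroneckerLimitFormula.lean` §1 — the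
arithmetic ray-class character values `rayClassCharValue 𝔪 ε 𝔟 = ε((𝔟, K(𝔪)/K))`, the Artin symbol being the tree's
multiplicative extension `artinSymbol (galFrob K K(𝔪))` of the CHOSEN Frobenius elements — and `RayClassLOfNormCharacter.lean`,
whose ★ `isRayClassL_of_norm_character` carries the identification
(hε) `∀ 𝔟, IsCoprime 𝔟 𝔪 → rayClassCharValue 𝔪 ε 𝔟 = χ (Ideal.absNorm 𝔟)` as an explicit HYPOTHESIS).

## What is proved

Let `K` be a number field, `𝔪` an integral ideal, `ζ ∈ K(𝔪)` a primitive `m`-th root of unity (so `μ_m ⊂ K(𝔪)`), and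
`χ` a Dirichlet character modulo `m` (values in `ℂ`).  THE character of `Gal(K(𝔪)/K)` "`χ` through the norm" is
`ε := χ.toUnitHom ∘ χ_cyc` where `χ_cyc = hζ.autToPow K : Gal(K(𝔪)/K) → (ℤ/m)ˣ` is Mathlib's cyclotomic character on `μ_m`
(`σ ζ = ζ^{χ_cyc(σ)}`, `IsPrimitiveRoot.autToPow`; no new definition is introduced — `ε` is this term).

* `autToPow_galFrob_eq_absNorm` — **`χ_cyc(Frob_𝔮) = N𝔮 mod m`** for every non-zero prime `𝔮` of `K` with `m ∉ 𝔮`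
  (Tate's Proposition `F(v)ζ = ζ^{Nv}`; Neukirch: "the Frobenius automorphism `φ_p : ζ → ζ^p`"): the chosen Frobenius
  `galFrob K K(𝔪) 𝔮` satisfies `Frob_𝔮 ζ ≡ ζ^{N𝔮}` modulo a prime above `𝔮`, and the `m`-th roots of unity stay distinct
  there (`galFrob_smul_of_pow_eq_one`).  NO unramifiedness hypothesis is needed for this (the congruence characterises the
  action on `μ_m` of ANY Frobenius lift).
* `normCharacter_galFrob` — hence **`ε(Frob_𝔮) = χ(N𝔮)`**.
* `rayClassCharValue_normCharacter_of_forall_not_mem` — **`ε((𝔟, K(𝔪)/K)) = χ(N𝔟)` for every non-zero `𝔟` none of whose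
  prime factors contains `m`** (multiplicativity of the Artin symbol `artinSymbol_mul` and of `N`, unique factorisation —
  Tate's Corollary `F(𝔞)ζ = ζ^{N𝔞}`); the modulus `𝔪` plays no role in this form.
* ★ `rayClassCharValue_normCharacter` — **(hε) VERBATIM**: if `𝔪 ≠ O_K` and every prime ideal containing `m` divides `𝔪`
  (`supp(m) ⊆ supp(𝔪)`: then "`𝔟` prime to `𝔪`" forces "no prime factor of `𝔟` contains `m`"), then
  `∀ 𝔟, IsCoprime 𝔟 𝔪 → rayClassCharValue 𝔪 ε 𝔟 = χ (Ideal.absNorm 𝔟)`.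
* `normCharacter_absNorm_eq_zero_of_not_isCoprime` — **(hcop)**: if every prime ideal dividing `𝔪` has residue
  characteristic NOT prime to `m` (`supp(𝔪) ⊆ supp(m)`), then `∀ 𝔟, ¬ IsCoprime 𝔟 𝔪 → χ (Ideal.absNorm 𝔟) = 0`.
* ★★ `isRayClassL_normCharacter` — ★ of `RayClassLOfNormCharacter.lean` with (hε) AND (hcop) DISCHARGED: for a quadratic `K`
  of odd discriminant, `𝔪 ≠ O_K` with `supp(𝔪) = supp(m)` in the two senses above, `χ ≠ 1` and a Dirichlet character `Ψ` with
  `Ψ(n) = χ(n)χ_{d_K}(n)`, `Ψ ≠ 1`: `IsRayClassL 𝔪 ε (s ↦ L(s, χ)·L(s, Ψ))` — hypothesis-free up to (`χ ≠ 1`, `Ψ ≠ 1`).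
* `normCharacter_apply_of_apply_eq_pow` — the value of `ε` on any `σ` with `σ ζ = ζ^a`: `ε(σ) = χ(a)` (how a consumer reads
  `ε` on an explicitly known automorphism, e.g. a layer character `η₁κ` read on a compatible root system).

Use (cell bsd-cm, crux `EllipticUnitValueSevenOfGZK` = stmt-BirchSwinnertonDyer-19945, K1ᵘ input (5), its print column item
A7, seat bsd-cm-k-ty1 g26, SUMMON GENUS-UNIT-A5 block (A5-1)): for `K = ℚ(√−7)`, `𝔪 = 7^{n+1}𝔣` (`𝔣 = 𝔭·(D)`, `𝔭² = (7)`),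
`m = 7^{n+1}|D|`: every prime over `7` or over a prime divisor of `D` divides `𝔪`, and every prime of `𝔪` lies over `7|D|`,
so both support hypotheses hold and A7 is a THEOREM for the route's characters `ε = (η₁κ) ∘ N`.  HONEST LABEL: nothing here
concerns an elliptic curve or BSD; no summit statement is proved; 19945 stays OPEN.

## References
* J. Tate, *Global class field theory*, Ch. VII of Cassels–Fröhlich (1967), §3.4 Proposition («`F(v_p)ζ = ζ^p` for all
  `p ∉ S`») and Corollary («`F((a)^S)ζ = ζ^a`»). [TateGCFT1967]
* J. Neukirch, *Algebraic Number Theory* (1999), Ch. VI §5 (5.3) Proposition and its proof («`(p, ℚ_p(ζ)|ℚ_p)` is the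
  Frobenius automorphism `φ_p : ζ → ζ^p`»), Ch. VII §10 opening («`(ℤ/mℤ)* ≅ G`, `p mod m ↦ φ_p`, `φ_p ζ = ζ^p for ζ ∈ μ_m`;
  «we may interpret `χ` as a character of the Galois group `G`») and (10.4) Proposition (iv). [NeukirchANT1999]
* K. Kato, Astérisque 295 (2004) §15.5 (15.5.1) (p. 253: "`χ(𝔟)` denotes `χ((𝔟, K(𝔣)/K))`"). [Kato2004Asterisque]
* Tree: `GaloisRepresentations/CyclotomicFrobenius.lean` (`galFrob`, `galFrob_smul_of_pow_eq_one`, and the model proofs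
  `val_cycloChar_galFrob` / `val_artinSymbol_frobChar` for `N = K(ζ_m)` itself), `LFunctions/AbelianFrobeniusDensity.lean`
  (`artinSymbol`, `artinSymbol_mul`, `artinSymbol_asIdeal`), `KroneckerLimitFormula.lean` (`rayClassCharValue`),
  `RayClassLOfNormCharacter.lean` (★ `isRayClassL_of_norm_character`); Mathlib `IsPrimitiveRoot.autToPow`, `autToPow_spec`.
-/

noncomputable section

open scoped NumberField
open IsDedekindDomain NumberField
open Literature.NumberTheory.NumberFields (rayClassField)
open Literature.NumberTheory.GaloisRepresentations (galFrob galFrob_smul_of_pow_eq_one)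
open Literature.NumberTheory.LFunctions.AbelianDensity (artinSymbol artinSymbol_mul artinSymbol_asIdeal
  artinSymbol_finsuppProd)
open Literature.NumberTheory.QuadraticFields (jacobiChar)

namespace Literature.NumberTheory.ComplexMultiplication.EllipticUnits

variable {K : Type} [Field K] [NumberField K]

/-! ## §1 The cyclotomic character of `Gal(K(𝔪)/K)` on `μ_m ⊂ K(𝔪)` at the Frobenius elements -/

section Frobenius

variable {𝔪 : Ideal (𝓞 K)} {m : ℕ} [NeZero m] {ζ : rayClassField K 𝔪}

/-- **`Frob_𝔮 ζ = ζ^{N𝔮}`** for a primitive `m`-th root of unity `ζ ∈ K(𝔪)` and a non-zero prime `𝔮` of `K` with `m ∉ 𝔮`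
(the chosen Frobenius `galFrob K K(𝔪) 𝔮`; Tate §3.4 Proposition, Neukirch VI (5.3) proof «`φ_p : ζ → ζ^p`»).
[cite: TateGCFT1967, Ch. VII §3.4 Proposition] [cite: NeukirchANT1999, Ch. VI §5 (5.3) Proposition (proof)] -/
theorem galFrob_apply_eq_pow_absNorm (hζ : IsPrimitiveRoot ζ m) (q : HeightOneSpectrum (𝓞 K))
    (hm : (m : 𝓞 K) ∉ q.asIdeal) :
    galFrob K (rayClassField K 𝔪) q ζ = ζ ^ Ideal.absNorm q.asIdeal := by
  set ζ' : 𝓞 (rayClassField K 𝔪) := ⟨ζ, hζ.isIntegral (NeZero.pos m)⟩ with hζ'def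
  have hζ' : ((ζ' : 𝓞 (rayClassField K 𝔪)) : rayClassField K 𝔪) = ζ := rfl
  have hζ'm : ζ' ^ m = 1 := by
    apply RingOfIntegers.coe_injective
    rw [map_pow, map_one, ← RingOfIntegers.coe_eq_algebraMap, hζ']
    exact hζ.pow_eq_one
  have h0 := galFrob_smul_of_pow_eq_one (K := K) (N := rayClassField K 𝔪) hζ'm hm
  have h1 := congrArg (fun x : 𝓞 (rayClassField K 𝔪) => (x : rayClassField K 𝔪)) h0
  simp only [GaloisRepresentations.RingOfIntegers.coe_galois_smul] at h1
  rw [hζ'] at h1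
  rw [h1, RingOfIntegers.coe_eq_algebraMap, map_pow, ← RingOfIntegers.coe_eq_algebraMap, hζ']

/-- **`χ_cyc(Frob_𝔮) = N𝔮 mod m`** — the cyclotomic character `hζ.autToPow K` of `Gal(K(𝔪)/K)` on `μ_m = ⟨ζ⟩ ⊂ K(𝔪)` at the
Frobenius of a non-zero prime `𝔮 ∌ m` is the absolute norm of `𝔮` (Tate's Proposition over `K`: `F(v)ζ = ζ^{Nv}`).
[cite: TateGCFT1967, Ch. VII §3.4 Proposition] [cite: NeukirchANT1999, Ch. VII §10 (opening: «p mod m ↦ φ_p, φ_p ζ = ζ^p»)] -/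
theorem autToPow_galFrob_eq_absNorm (hζ : IsPrimitiveRoot ζ m) (q : HeightOneSpectrum (𝓞 K))
    (hm : (m : 𝓞 K) ∉ q.asIdeal) :
    ((hζ.autToPow K (galFrob K (rayClassField K 𝔪) q) : (ZMod m)ˣ) : ZMod m) =
      (Ideal.absNorm q.asIdeal : ZMod m) := by
  have h1 := galFrob_apply_eq_pow_absNorm hζ q hm
  rw [← hζ.autToPow_spec K (galFrob K (rayClassField K 𝔪) q)] at h1
  have hmpos : 0 < m := NeZero.pos m
  have key : ∀ a : ℕ, ζ ^ (a % m) = ζ ^ a := fun a => by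
    conv_rhs => rw [← Nat.mod_add_div a m]
    rw [pow_add, pow_mul, hζ.pow_eq_one, one_pow, mul_one]
  have h4 : ζ ^ (((hζ.autToPow K (galFrob K (rayClassField K 𝔪) q) : (ZMod m)ˣ) : ZMod m).val % m) =
      ζ ^ (Ideal.absNorm q.asIdeal % m) := by
    rw [key, key, h1]
  have h3 : ((hζ.autToPow K (galFrob K (rayClassField K 𝔪) q) : (ZMod m)ˣ) : ZMod m).val ≡
      Ideal.absNorm q.asIdeal [MOD m] := hζ.pow_inj (Nat.mod_lt _ hmpos) (Nat.mod_lt _ hmpos) h4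
  rw [← ZMod.natCast_eq_natCast_iff] at h3
  rwa [ZMod.natCast_zmod_val] at h3

/-- **`ε(Frob_𝔮) = χ(N𝔮)`** for `ε = χ ∘ χ_cyc` («`χ` through the norm»: Neukirch VII §10, «we may interpret `χ` as a character
of the Galois group»), `𝔮` a non-zero prime with `m ∉ 𝔮`.
[cite: NeukirchANT1999, Ch. VII §10 (opening) and (10.4) Proposition (iv)] [cite: TateGCFT1967, Ch. VII §3.4 Proposition] -/
theorem normCharacter_galFrob (hζ : IsPrimitiveRoot ζ m) (χ : DirichletCharacter ℂ m)
    (q : HeightOneSpectrum (𝓞 K)) (hm : (m : 𝓞 K) ∉ q.asIdeal) :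
    ((((χ.toUnitHom.comp (hζ.autToPow K)) (galFrob K (rayClassField K 𝔪) q) : ℂˣ)) : ℂ) =
      χ (Ideal.absNorm q.asIdeal) := by
  rw [MonoidHom.comp_apply, MulChar.coe_toUnitHom, autToPow_galFrob_eq_absNorm hζ q hm]

/-- **The value of `ε = χ ∘ χ_cyc` on an automorphism with known action on `ζ`**: if `σ ζ = ζ^a` then `ε(σ) = χ(a)` (how a
layer character given on a root system is read). [cite: NeukirchANT1999, Ch. VII §10 (opening)] -/
theorem normCharacter_apply_of_apply_eq_pow (hζ : IsPrimitiveRoot ζ m) (χ : DirichletCharacter ℂ m)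
    (σ : rayClassField K 𝔪 ≃ₐ[K] rayClassField K 𝔪) {a : ℕ} (ha : σ ζ = ζ ^ a) :
    ((((χ.toUnitHom.comp (hζ.autToPow K)) σ : ℂˣ)) : ℂ) = χ a := by
  rw [MonoidHom.comp_apply, MulChar.coe_toUnitHom]
  congr 1
  have h1 := hζ.autToPow_spec K σ
  rw [ha] at h1
  have hmpos : 0 < m := NeZero.pos m
  have key : ∀ b : ℕ, ζ ^ (b % m) = ζ ^ b := fun b => by
    conv_rhs => rw [← Nat.mod_add_div b m]
    rw [pow_add, pow_mul, hζ.pow_eq_one, one_pow, mul_one]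
  have h4 : ζ ^ (((hζ.autToPow K σ : (ZMod m)ˣ) : ZMod m).val % m) = ζ ^ (a % m) := by rw [key, key, h1]
  have h3 : ((hζ.autToPow K σ : (ZMod m)ˣ) : ZMod m).val ≡ a [MOD m] :=
    hζ.pow_inj (Nat.mod_lt _ hmpos) (Nat.mod_lt _ hmpos) h4
  rw [← ZMod.natCast_eq_natCast_iff, ZMod.natCast_zmod_val] at h3
  exact h3

end Frobenius

/-! ## §2 The Artin symbol: `ε((𝔟, K(𝔪)/K)) = χ(N𝔟)` (Tate's Corollary `F(𝔞)ζ = ζ^{N𝔞}`) -/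

section ArtinSymbol

open scoped Classical

variable {𝔪 : Ideal (𝓞 K)} {m : ℕ} [NeZero m] {ζ : rayClassField K 𝔪}

/-- The Artin symbol of the unit ideal is trivial, so `ε(O_K) = 1`. [cite: NeukirchANT1999, Ch. VII §6 (before (6.8))] -/
theorem rayClassCharValue_top (ε : (rayClassField K 𝔪 ≃ₐ[K] rayClassField K 𝔪) →* ℂˣ) :
    rayClassCharValue 𝔪 ε ⊤ = 1 := by
  have htop : artinSymbol (galFrob K (rayClassField K 𝔪)) (⊤ : Ideal (𝓞 K)) = 1 := by
    have h := artinSymbol_finsuppProd (galFrob K (rayClassField K 𝔪)) (0 : HeightOneSpectrum (𝓞 K) →₀ ℕ)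
    simpa only [Finsupp.prod_zero_index, Ideal.one_eq_top] using h
  rw [rayClassCharValue, htop, map_one, Units.val_one]

/-- Multiplicativity: `ε((IJ, K(𝔪)/K)) = ε((I, K(𝔪)/K))·ε((J, K(𝔪)/K))` on non-zero ideals (the Artin symbol is
multiplicative). [cite: NeukirchANT1999, Ch. VII §6 (before (6.8)) and Ch. VI §7 (7.1)] -/
theorem rayClassCharValue_mul (ε : (rayClassField K 𝔪 ≃ₐ[K] rayClassField K 𝔪) →* ℂˣ) {I J : Ideal (𝓞 K)}
    (hI : I ≠ ⊥) (hJ : J ≠ ⊥) :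
    rayClassCharValue 𝔪 ε (I * J) = rayClassCharValue 𝔪 ε I * rayClassCharValue 𝔪 ε J := by
  rw [rayClassCharValue, rayClassCharValue, rayClassCharValue, artinSymbol_mul _ hI hJ, map_mul, Units.val_mul]

/-- On a non-zero prime: `ε((𝔮, K(𝔪)/K)) = ε(Frob_𝔮)`. [cite: NeukirchANT1999, Ch. VI §7 (7.1) (the Artin symbol on primes)] -/
theorem rayClassCharValue_asIdeal (ε : (rayClassField K 𝔪 ≃ₐ[K] rayClassField K 𝔪) →* ℂˣ)
    (q : HeightOneSpectrum (𝓞 K)) :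
    rayClassCharValue 𝔪 ε q.asIdeal = ((ε (galFrob K (rayClassField K 𝔪) q) : ℂˣ) : ℂ) := by
  rw [rayClassCharValue, artinSymbol_asIdeal]

/-- **`ε((𝔟, K(𝔪)/K)) = χ(N𝔟)` for every non-zero ideal `𝔟` none of whose prime factors contains `m`** (Tate's Corollary
over `K`: `F(𝔟)ζ = ζ^{N𝔟}`; both sides are multiplicative in `𝔟` — unique factorisation).  The modulus `𝔪` plays no role.
[cite: TateGCFT1967, Ch. VII §3.4 Corollary] [cite: NeukirchANT1999, Ch. VII §10 (opening) and (10.4) Proposition (iv)] -/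
theorem rayClassCharValue_normCharacter_of_forall_not_mem (hζ : IsPrimitiveRoot ζ m) (χ : DirichletCharacter ℂ m)
    {I : Ideal (𝓞 K)} (hI : I ≠ ⊥)
    (hIm : ∀ v : HeightOneSpectrum (𝓞 K), v.asIdeal ∣ I → (m : 𝓞 K) ∉ v.asIdeal) :
    rayClassCharValue 𝔪 (χ.toUnitHom.comp (hζ.autToPow K)) I = χ (Ideal.absNorm I) := by
  induction I using UniqueFactorizationMonoid.induction_on_prime with
  | h₁ => exact absurd rfl hI
  | h₂ J hJ =>
    rw [Ideal.isUnit_iff] at hJ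
    subst hJ
    rw [rayClassCharValue_top, Ideal.absNorm_top, Nat.cast_one, map_one]
  | h₃ J P hJ hP ih =>
    have hP0 : P ≠ ⊥ := hP.ne_zero
    let v : HeightOneSpectrum (𝓞 K) := ⟨P, Ideal.isPrime_of_prime hP, hP0⟩
    have hvP : v.asIdeal = P := rfl
    have hmv : (m : 𝓞 K) ∉ v.asIdeal := hIm v ⟨J, by rw [hvP]⟩
    have ih' := ih hJ fun w hw => hIm w (dvd_mul_of_dvd_right hw P)
    rw [rayClassCharValue_mul _ hP0 hJ, ih', ← hvP, rayClassCharValue_asIdeal, normCharacter_galFrob hζ χ v hmv,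
      map_mul, Nat.cast_mul, map_mul]

omit [NumberField K] in
/-- An ideal prime to `𝔪` has no prime factor dividing `𝔪`; so if every prime containing `m` divides `𝔪`, no prime factor of
`𝔟` contains `m`. [cite: NeukirchANT1999, Ch. VI §1 (ideals prime to 𝔪)] -/
theorem forall_not_mem_of_isCoprime {𝔪 : Ideal (𝓞 K)} {m : ℕ}
    (hm𝔪 : ∀ v : HeightOneSpectrum (𝓞 K), (m : 𝓞 K) ∈ v.asIdeal → v.asIdeal ∣ 𝔪)
    {𝔟 : Ideal (𝓞 K)} (h𝔟 : IsCoprime 𝔟 𝔪) :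
    ∀ v : HeightOneSpectrum (𝓞 K), v.asIdeal ∣ 𝔟 → (m : 𝓞 K) ∉ v.asIdeal := by
  intro v hv hmv
  have h1 : 𝔟 ≤ v.asIdeal := Ideal.le_of_dvd hv
  have h2 : 𝔪 ≤ v.asIdeal := Ideal.le_of_dvd (hm𝔪 v hmv)
  have htop : (⊤ : Ideal (𝓞 K)) ≤ v.asIdeal := by
    rw [← Ideal.isCoprime_iff_sup_eq.mp h𝔟]
    exact sup_le h1 h2
  exact v.isPrime.ne_top (top_le_iff.mp htop)

/-- ★ **(hε) AS A THEOREM — `ε((𝔟, K(𝔪)/K)) = χ(N𝔟)` for every `𝔟` prime to `𝔪`**, for `ε = χ ∘ χ_cyc` on `μ_m = ⟨ζ⟩ ⊂ K(𝔪)`,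
a proper modulus `𝔪 ≠ O_K`, and `supp(m) ⊆ supp(𝔪)` (every prime ideal containing `m` divides `𝔪`).  The conclusion is
LETTER FOR LETTER the hypothesis `hε` of `isRayClassL_of_norm_character` / `rayClassLSeries_eq_tsum_twist`.
[cite: TateGCFT1967, Ch. VII §3.4 Proposition and Corollary] [cite: NeukirchANT1999, Ch. VI §5 (5.3) Proposition (proof), Ch. VII §10 (10.4) Proposition (iv)] [cite: Kato2004Asterisque, §15.5 (15.5.1) (p. 253, «χ(𝔟) denotes χ((𝔟, K(𝔣)/K))»)] -/
theorem rayClassCharValue_normCharacter (hζ : IsPrimitiveRoot ζ m) (χ : DirichletCharacter ℂ m) (h𝔪 : 𝔪 ≠ ⊤)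
    (hm𝔪 : ∀ v : HeightOneSpectrum (𝓞 K), (m : 𝓞 K) ∈ v.asIdeal → v.asIdeal ∣ 𝔪) :
    ∀ 𝔟 : Ideal (𝓞 K), IsCoprime 𝔟 𝔪 →
      rayClassCharValue 𝔪 (χ.toUnitHom.comp (hζ.autToPow K)) 𝔟 = χ (Ideal.absNorm 𝔟) := by
  intro 𝔟 h𝔟
  have h𝔟0 : 𝔟 ≠ ⊥ := by
    rintro rfl
    exact h𝔪 (Ideal.isUnit_iff.mp (isCoprime_zero_left.mp h𝔟))
  exact rayClassCharValue_normCharacter_of_forall_not_mem hζ χ h𝔟0 (forall_not_mem_of_isCoprime hm𝔪 h𝔟)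

/-- **(hcop) AS A THEOREM — `χ(N𝔟) = 0` for every `𝔟` NOT prime to `𝔪`**, provided every prime ideal dividing `𝔪` has
residue characteristic not prime to `m` (`supp(𝔪) ⊆ supp(m)`): a common prime `𝔮 ⊇ 𝔟 + 𝔪` gives `N𝔮 ∣ N𝔟` with
`(N𝔮, m) ≠ 1`, so `N𝔟 mod m` is not a unit and `χ` vanishes there.  The conclusion is LETTER FOR LETTER the hypothesis
`hcop` of `isRayClassL_of_norm_character`. [cite: NeukirchANT1999, Ch. VII §10 (10.4) Proposition (iv) («χ(𝔭) = 0 for 𝔭 | 𝔣»)] -/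
theorem normCharacter_absNorm_eq_zero_of_not_isCoprime {𝔪 : Ideal (𝓞 K)} {m : ℕ} (χ : DirichletCharacter ℂ m)
    (h𝔪m : ∀ v : HeightOneSpectrum (𝓞 K), v.asIdeal ∣ 𝔪 → ¬ (Ideal.absNorm v.asIdeal).Coprime m) :
    ∀ 𝔟 : Ideal (𝓞 K), ¬ IsCoprime 𝔟 𝔪 → χ (Ideal.absNorm 𝔟) = 0 := by
  intro 𝔟 h𝔟
  rw [Ideal.isCoprime_iff_sup_eq] at h𝔟
  obtain ⟨P, hPmax, hP⟩ := Ideal.exists_le_maximal (𝔟 ⊔ 𝔪) h𝔟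
  have hP0 : P ≠ ⊥ := Ring.ne_bot_of_isMaximal_of_not_isField hPmax (RingOfIntegers.not_isField K)
  let v : HeightOneSpectrum (𝓞 K) := ⟨P, hPmax.isPrime, hP0⟩
  have hv𝔪 : v.asIdeal ∣ 𝔪 := Ideal.dvd_iff_le.mpr (le_sup_right.trans hP)
  have hv𝔟 : Ideal.absNorm v.asIdeal ∣ Ideal.absNorm 𝔟 := Ideal.absNorm_dvd_absNorm_of_le (le_sup_left.trans hP)
  apply MulChar.map_nonunit
  rw [ZMod.isUnit_iff_coprime]
  exact fun h => h𝔪m v hv𝔪 (Nat.Coprime.coprime_dvd_left hv𝔟 h)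

end ArtinSymbol

/-! ## §3 ★★ The `IsRayClassL` witness for `ε = χ ∘ χ_cyc` with (hε) and (hcop) discharged -/

section Witness

variable {𝔪 : Ideal (𝓞 K)} {m : ℕ} [NeZero m] {ζ : rayClassField K 𝔪}

/-- **`L_{K,𝔪}(χ ∘ χ_cyc, s) = Σ_𝔟 χ(N𝔟)N𝔟^{−s}`** (all `s`) under the two support hypotheses.
[cite: NeukirchANT1999, Ch. VII §10 (10.4) Proposition (iv)] [cite: Kato2004Asterisque, §15.5 (p. 253)] -/
theorem rayClassLSeries_normCharacter_eq_tsum_twist (hζ : IsPrimitiveRoot ζ m) (χ : DirichletCharacter ℂ m) (h𝔪 : 𝔪 ≠ ⊤)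
    (hm𝔪 : ∀ v : HeightOneSpectrum (𝓞 K), (m : 𝓞 K) ∈ v.asIdeal → v.asIdeal ∣ 𝔪)
    (h𝔪m : ∀ v : HeightOneSpectrum (𝓞 K), v.asIdeal ∣ 𝔪 → ¬ (Ideal.absNorm v.asIdeal).Coprime m) (s : ℂ) :
    rayClassLSeries 𝔪 (χ.toUnitHom.comp (hζ.autToPow K)) s =
      ∑' 𝔟 : Ideal (𝓞 K), χ (Ideal.absNorm 𝔟) * ((Ideal.absNorm 𝔟 : ℕ) : ℂ) ^ (-s) :=
  rayClassLSeries_eq_tsum_twist _ χ (rayClassCharValue_normCharacter hζ χ h𝔪 hm𝔪)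
    (normCharacter_absNorm_eq_zero_of_not_isCoprime χ h𝔪m) s

/-- ★★ **THE `IsRayClassL` WITNESS FOR `ε = χ ∘ χ_cyc`, (hε) and (hcop) DISCHARGED** (Artin factorisation, row A7 of the
K1ᵘ print column): for a quadratic `K` with odd discriminant, a proper modulus `𝔪 ∌ 1` whose prime support is that of `m`
(`supp(m) ⊆ supp(𝔪)` and `supp(𝔪) ⊆ supp(m)` in the senses above), `μ_m = ⟨ζ⟩ ⊂ K(𝔪)`, a Dirichlet character `χ ≠ 1` mod `m`
and any `Ψ ≠ 1` with `Ψ(n) = χ(n)χ_{d_K}(n)`: the entire function `s ↦ L(s, χ)·L(s, Ψ)` continues `L_{K,𝔪}(χ ∘ χ_cyc, s)`.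
[cite: NeukirchANT1999, Ch. VII §10 (10.4) Proposition (iv), (10.5) Corollary] [cite: TateGCFT1967, Ch. VII §3.4 Corollary] -/
theorem isRayClassL_normCharacter (h2 : Module.finrank ℚ K = 2) (hodd : Odd (NumberField.discr K))
    (hζ : IsPrimitiveRoot ζ m) (χ : DirichletCharacter ℂ m) (hχ : χ ≠ 1) (h𝔪 : 𝔪 ≠ ⊤)
    (hm𝔪 : ∀ v : HeightOneSpectrum (𝓞 K), (m : 𝓞 K) ∈ v.asIdeal → v.asIdeal ∣ 𝔪)
    (h𝔪m : ∀ v : HeightOneSpectrum (𝓞 K), v.asIdeal ∣ 𝔪 → ¬ (Ideal.absNorm v.asIdeal).Coprime m)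
    {M : ℕ} [NeZero M] (Ψ : DirichletCharacter ℂ M)
    (hΨ : ∀ n : ℕ, Ψ n = χ n * jacobiChar (NumberField.discr K).natAbs n) (hΨ1 : Ψ ≠ 1) :
    IsRayClassL 𝔪 (χ.toUnitHom.comp (hζ.autToPow K)) (fun s => χ.LFunction s * Ψ.LFunction s) :=
  isRayClassL_of_norm_character h2 hodd _ χ hχ (rayClassCharValue_normCharacter hζ χ h𝔪 hm𝔪)
    (normCharacter_absNorm_eq_zero_of_not_isCoprime χ h𝔪m) Ψ hΨ hΨ1

/-- ★★′ The same with the canonical second character `Ψ = χ·(·/|d_K|)` modulo `m·|d_K|`.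
[cite: NeukirchANT1999, Ch. VII §10 (10.4) Proposition (iv), (10.5) Corollary] -/
theorem isRayClassL_normCharacter' (h2 : Module.finrank ℚ K = 2) (hodd : Odd (NumberField.discr K))
    (hζ : IsPrimitiveRoot ζ m) (χ : DirichletCharacter ℂ m) (hχ : χ ≠ 1) (h𝔪 : 𝔪 ≠ ⊤)
    (hm𝔪 : ∀ v : HeightOneSpectrum (𝓞 K), (m : 𝓞 K) ∈ v.asIdeal → v.asIdeal ∣ 𝔪)
    (h𝔪m : ∀ v : HeightOneSpectrum (𝓞 K), v.asIdeal ∣ 𝔪 → ¬ (Ideal.absNorm v.asIdeal).Coprime m)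
    [NeZero (m * (NumberField.discr K).natAbs)]
    (hΨ1 : DirichletCharacter.changeLevel (dvd_mul_right m (NumberField.discr K).natAbs) χ *
        DirichletCharacter.changeLevel (dvd_mul_left (NumberField.discr K).natAbs m)
          (jacobiChar (NumberField.discr K).natAbs) ≠ 1) :
    IsRayClassL 𝔪 (χ.toUnitHom.comp (hζ.autToPow K)) (fun s => χ.LFunction s *
      (DirichletCharacter.changeLevel (dvd_mul_right m (NumberField.discr K).natAbs) χ *
        DirichletCharacter.changeLevel (dvd_mul_left (NumberField.discr K).natAbs m)
          (jacobiChar (NumberField.discr K).natAbs)).LFunction s) :=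
  isRayClassL_normCharacter h2 hodd hζ χ hχ h𝔪 hm𝔪 h𝔪m _ (changeLevel_mul_jacobiChar_natCast χ) hΨ1

end Witness

end Literature.NumberTheory.ComplexMultiplication.EllipticUnits

end
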